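import Literature.NumberTheory.EllipticCurves.LocalEulerCharacteristicTorsion
import Literature.NumberTheory.EllipticCurves.LocalWeilPairingDuality
import Literature.NumberTheory.EllipticCurves.ZpExtensionGaloisTwistWeilDual
import Literature.NumberTheory.EllipticCurves.CongruenceVisibilityLocalFactors
import Literature.NumberTheory.EllipticCurves.SelmerCorankControlRatProofs
import Summits.BirchSwinnertonDyer.Rank1Residual.GaloisImage.LocalEulerPoincareCharacteristicHolds
import Summits.BirchSwinnertonDyer.BirchSwinnertonDyer.Theorems.ThetaPartnerAtTwoSignedKatoUpToAtTwoLocalTowerResInjective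
import HarnessLib

/-!
# Road T for item 23110, H-PLUSDUAL brick (K3): `#H¹(ℚ_v, E[2^J](χ_u)) = 4^J`, `H⁰ = H² = 0` for the twisted torsion
# modules at the place above `2` — Tate's local Euler–Poincaré characteristic (a tree THEOREM) + no `2`-power torsion over
# the local tower

Routes `ResidualThetaTransportAtTwo` (RTT, crux r201 `ResidualLambdaFormulaNegDiscAtTwo`, stmt-BirchSwinnertonDyer-23110) /
`ThetaPartnerAtTwo` (TP2). Seat `prover-bsd-wall-tp2-p2x-w2` g15; `--supports stmt-BirchSwinnertonDyer-23110`. THEOREMS ONLY (no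
definition, no named fact, no `sorry`); closes nothing.

WHY. The `±`-duality at `2` (`hdual` of the lead's `…RlfTwistedUniformExponent`, Kim 2007 Prop. 3.18 read at `2`, twisted, level `ℚ`)
is proved by COUNTING + isotropy: `w_*(L_{u'}) = L_u^⊥` in `H¹(ℚ_v, E[2^J](χ_u))` as soon as both sides are isotropic and
`#L_u · #L_{u'} = #H¹(ℚ_v, E[2^J](χ_u))` (tree `forall_mem_apply_eq_zero_iff_of_isotropic_of_card_le`). THIS FILE supplies the
right-hand side: for EVERY odd `u` and every `J`, `#H¹(ℚ_v, E[2^J](χ_u)|_{Γ_{ℚ_v}}) = 2^{2J}`.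

* §1 (any number field `K`, prime `p`, place `v`, level `J`, `u ≡ 1 (p)`; displayed hypothesis (FIX): no non-zero point of
  `E[p^J]` is fixed by the local `Gal(K̄_v/(K_∞)_w)`) `invariants_twistedTorsion_restrictField_eq_bot` — `H⁰(K_v, E[p^J](χ_u)) = 0`
  (on `Gal(K̄_v/(K_∞)_w)` the twist is invisible: `galoisTwist_apply_of_mem_kerSubgroup`);
  `natCard_galoisCohomology_two_twistedTorsion_eq_one` — `#H²(K_v, E[p^J](χ_u)) = 1`: the tree's PROVED `(2,0)`-duality
  `natCard_two_eq_natCard_invariants_homRep` (`#H² = #Hom_Γ(M, μ)`), every `μ`-valued character of `E[p^J]` is `e(·, T)` (Weil pairing,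
  `weilDualLocalHom_bijective`), and an equivariant one has `T` fixed by `Gal(K̄_v/(K_∞)_w)` (`weilDualLocalHom_smul`, injectivity);
  `natCard_galoisCohomology_one_twistedTorsion` — `#H¹(K_v, E[p^J](χ_u)) = #(𝓞_v ⧸ p^{2J})` by Tate's local Euler–Poincaré
  characteristic, a tree THEOREM (`localEulerPoincareCharacteristic_holds`, via `localEulerPoincareCharacteristic_adicCompletion`).
* §2 (`K = ℚ`, `p = 2`, `W` globally minimal with `GoodSS W 2`) `natCard_adicCompletionIntegers_quot_two_pow` (`#(ℤ₂/2^k) = 2^k`),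
  (FIX) discharged by `eq_zero_of_mem_localTowerPointsOfEmb_of_pow_nsmul_two` + `pointsMapOfEmb_mem_localTowerPointsOfEmb_of_forall_smul`,
  and **`natCard_galoisCohomology_one_twistedTorsion_two` : `#H¹(ℚ_v, E[2^J](χ_u)) = 4^J`** (with the `H⁰`, `H²` statements).

HONEST FRAMING: a local count; closes nothing; `hdual` is NOT proved here; 23110 is NOT proved; BSD is not proved by any of this.
References: [MilneADT2006] I Thm. 2.8, Cor. 2.3; [GreenbergLNM1716] §4 p. 123 («`H⁰(F, A_s) = 0`»); [BDKim2007] Prop. 3.15 (the count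
`#M_n/p^j M_n` «using Tate's Euler characteristic formula»); [SilvermanAEC2009] III.8.1.
-/

set_option autoImplicit false
-- the Theorems namespace of this sub repeats the summit name by design (D-0017 nested layout)
set_option linter.dupNamespace false

noncomputable section

open scoped Classical NumberField
open CategoryTheory Function Field NumberField IsDedekindDomain

namespace Summit.BirchSwinnertonDyer.BirchSwinnertonDyer.Theorems.SignedEC.TwistedLocalCount

open Literature.NumberTheory.EllipticCurves Literature.NumberTheory.GaloisRepresentations WeierstrassCurve ZpExtension
open Literature.NumberTheory.GaloisRepresentations.DiscreteGaloisModule (mu MuCarrier)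
open scoped ContRepresentation

universe u

/-! ## §1 Any number field: `H⁰ = 0`, `#H² = 1`, `#H¹ = #(𝓞_v / p^{2J})` under (FIX) -/

section General

variable {K : Type u} [Field K] [NumberField K] (W : WeierstrassCurve K) [W.IsElliptic] (p : ℕ) [Fact p.Prime]
  (κ : ZpExtension K p) (J : ℕ) (u : ℤ) (hu : (p : ℤ) ∣ u - 1) (v : HeightOneSpectrum (𝓞 K))

omit [W.IsElliptic] in
/-- **`H⁰(K_v, E[p^J](χ_u)) = 0`** when no non-zero point of `E[p^J]` is fixed by `Gal(K̄_v/(K_∞)_w)` (FIX): on that subgroup the twist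
`χ_u` is invisible, so an invariant of the twisted module is fixed by it. [cite: GreenbergLNM1716, §4 p. 107 and p. 123] -/
theorem invariants_twistedTorsion_restrictField_eq_bot
    (hfix : ∀ T : W.geomTorsion ((p ^ J : ℕ) : ℤ), (∀ τ : absoluteGaloisGroup (v.adicCompletion K),
      absGaloisRestrict K (v.adicCompletion K) τ ∈ κ.kerSubgroup → absGaloisRestrict K (v.adicCompletion K) τ • T = T) → T = 0) :
    ((W.twistedTorsionGaloisModule p κ J u hu).restrictField (v.adicCompletion K)).toTopRep.ρ.invariants = ⊥ := by
  rw [eq_bot_iff]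
  intro T hT
  rw [Submodule.mem_bot]
  refine hfix T fun τ hτ ↦ ?_
  have h := (Representation.mem_invariants _ T).1 hT τ
  change κ.galoisTwist (W.torsionGaloisModule ((p ^ J : ℕ) : ℤ)) J (W.pow_nsmul_geomTorsion_pow p J) u hu
    (absGaloisRestrict K (v.adicCompletion K) τ) T = T at h
  rwa [κ.galoisTwist_apply_of_mem_kerSubgroup _ J _ u hu hτ] at h

/-- **`#H²(K_v, E[p^J](χ_u)) = 1`** under (FIX), for a non-degenerate `Γ_K`-equivariant biadditive `μ_{p^J}`-valued pairing `e` on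
`E[p^J]` (a Weil pairing). `#H²(K_v, M) = #Hom_{Γ_{K_v}}(M, μ)` (tree, Milne I Cor. 2.3 in bidegree `(2,0)`); every character `E[p^J] → μ`
is `e(·, T)` (`weilDualLocalHom_bijective`), and equivariance on `Gal(K̄_v/(K_∞)_w)` — where `χ_u` is trivial — forces `T` to be fixed
there (`weilDualLocalHom_smul` + injectivity), hence `T = 0`. [cite: MilneADT2006, Ch. I, Cor. 2.3] [cite: SilvermanAEC2009, Prop. III.8.1] -/
theorem natCard_galoisCohomology_two_twistedTorsion_eq_one
    (e : W.geomTorsion ((p ^ J : ℕ) : ℤ) → W.geomTorsion ((p ^ J : ℕ) : ℤ) → AlgebraicClosure K)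
    (hμ : ∀ S T, e S T ^ (p ^ J) = 1) (hadd₁ : ∀ S₁ S₂ T, e (S₁ + S₂) T = e S₁ T * e S₂ T)
    (hadd₂ : ∀ S T₁ T₂, e S (T₁ + T₂) = e S T₁ * e S T₂)
    (hgal : ∀ (σ : absoluteGaloisGroup K) (S T : W.geomTorsion ((p ^ J : ℕ) : ℤ)), σ • e S T = e (σ • S) (σ • T))
    (hnondeg : ∀ T, (∀ S, e S T = 1) → T = 0)
    (hfix : ∀ T : W.geomTorsion ((p ^ J : ℕ) : ℤ), (∀ τ : absoluteGaloisGroup (v.adicCompletion K),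
      absGaloisRestrict K (v.adicCompletion K) τ ∈ κ.kerSubgroup → absGaloisRestrict K (v.adicCompletion K) τ • T = T) → T = 0) :
    Finite (galoisCohomology ((W.twistedTorsionGaloisModule p κ J u hu).restrictField (v.adicCompletion K)) 2) ∧
    Nat.card (galoisCohomology ((W.twistedTorsionGaloisModule p κ J u hu).restrictField (v.adicCompletion K)) 2) = 1 := by
  haveI : NeZero (p ^ J) := neZero_prime_pow p J
  haveI : CharZero (v.adicCompletion K) := charZero_adicCompletion v
  set F := v.adicCompletion K with hF
  haveI := absoluteGaloisGroup_compactSpace F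
  haveI : Finite (W.geomTorsion ((p ^ J : ℕ) : ℤ)) := finite_geomTorsion_of_neZero W (p ^ J)
  haveI : Finite (MuCarrier F (p ^ J)) := Literature.NumberTheory.EllipticCurves.finite_muCarrier (p ^ J) F
  set ρ : ContinuousRep (absoluteGaloisGroup F) ℤ (W.geomTorsion ((p ^ J : ℕ) : ℤ)) :=
    (W.twistedTorsionGaloisModule p κ J u hu).restrictField F with hρ
  set ρ₀ : ContinuousRep (absoluteGaloisGroup F) ℤ (W.geomTorsion ((p ^ J : ℕ) : ℤ)) :=
    GaloisRep.restrictField F (W.torsionGaloisModule ((p ^ J : ℕ) : ℤ)) with hρ₀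
  have hM : ∀ m : W.geomTorsion ((p ^ J : ℕ) : ℤ), p ^ J • m = 0 := W.pow_nsmul_geomTorsion_pow p J
  obtain ⟨hfin, hcard⟩ := natCard_two_eq_natCard_invariants_homRep F ρ hM
  refine ⟨hfin, ?_⟩
  change Nat.card (continuousCohomology 2 ρ.toTopRep) = 1
  rw [hcard]
  -- the invariants of `Hom(E[p^J](χ_u), μ)` vanish
  have hbot : ∀ f ∈ (ρ.homRep (mu F (p ^ J))).toTopRep.ρ.invariants, f = 0 := by
    intro f hf
    obtain ⟨T, rfl⟩ := (weilDualLocalHom_bijective W (p ^ J) e hμ hadd₁ hadd₂ F hnondeg).2 f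
    suffices hT : T = 0 by rw [hT, map_zero]
    refine hfix T fun τ hτ ↦ ?_
    have hinv := (Representation.mem_invariants _ _).1 hf τ
    change (ρ.homRep (mu F (p ^ J))) τ (weilDualLocalHom W (p ^ J) e hμ hadd₁ hadd₂ F T) = _ at hinv
    rw [ContinuousRep.homRep_apply_eq_self_iff] at hinv
    -- on `τ` the twisted action is the plain one
    have hplain : ∀ m, ρ τ m = ρ₀ τ m := fun m ↦ by
      change κ.galoisTwist (W.torsionGaloisModule ((p ^ J : ℕ) : ℤ)) J hM u hu (absGaloisRestrict K F τ) m = _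
      rw [κ.galoisTwist_apply_of_mem_kerSubgroup _ J hM u hu hτ]
      rfl
    have hinv₀ : (ρ₀.homRep (mu F (p ^ J))) τ (weilDualLocalHom W (p ^ J) e hμ hadd₁ hadd₂ F T) =
        weilDualLocalHom W (p ^ J) e hμ hadd₁ hadd₂ F T := by
      rw [ContinuousRep.homRep_apply_eq_self_iff]
      intro m
      rw [← hplain]
      exact hinv m
    rw [← weilDualLocalHom_smul W (p ^ J) e hμ hadd₁ hadd₂ F hgal τ T] at hinv₀
    exact weilDualLocalHom_injective W (p ^ J) e hμ hadd₁ hadd₂ F hnondeg hinv₀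
  haveI : Subsingleton (ρ.homRep (mu F (p ^ J))).toTopRep.ρ.invariants :=
    ⟨fun a b ↦ Subtype.ext ((hbot a a.2).trans (hbot b b.2).symm)⟩
  exact Nat.card_of_subsingleton (0 : (ρ.homRep (mu F (p ^ J))).toTopRep.ρ.invariants)

/-- **`#H¹(K_v, E[p^J](χ_u)) = #(𝓞_v ⧸ p^{2J} 𝓞_v)`** under (FIX), for a Weil pairing `e` on `E[p^J]`: Tate's local Euler–Poincaré
characteristic `#H⁰ · #H² · #(𝓞_v/#M) = #H¹` (the tree THEOREM `localEulerPoincareCharacteristic_holds`) with `#M = p^{2J}`,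
`#H⁰ = 1` (`invariants_twistedTorsion_restrictField_eq_bot`), `#H² = 1` (`natCard_galoisCohomology_two_twistedTorsion_eq_one`).
[cite: MilneADT2006, Ch. I §2, Thm. 2.8] -/
theorem natCard_galoisCohomology_one_twistedTorsion
    (e : W.geomTorsion ((p ^ J : ℕ) : ℤ) → W.geomTorsion ((p ^ J : ℕ) : ℤ) → AlgebraicClosure K)
    (hμ : ∀ S T, e S T ^ (p ^ J) = 1) (hadd₁ : ∀ S₁ S₂ T, e (S₁ + S₂) T = e S₁ T * e S₂ T)
    (hadd₂ : ∀ S T₁ T₂, e S (T₁ + T₂) = e S T₁ * e S T₂)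
    (hgal : ∀ (σ : absoluteGaloisGroup K) (S T : W.geomTorsion ((p ^ J : ℕ) : ℤ)), σ • e S T = e (σ • S) (σ • T))
    (hnondeg : ∀ T, (∀ S, e S T = 1) → T = 0)
    (hfix : ∀ T : W.geomTorsion ((p ^ J : ℕ) : ℤ), (∀ τ : absoluteGaloisGroup (v.adicCompletion K),
      absGaloisRestrict K (v.adicCompletion K) τ ∈ κ.kerSubgroup → absGaloisRestrict K (v.adicCompletion K) τ • T = T) → T = 0) :
    Finite (galoisCohomology ((W.twistedTorsionGaloisModule p κ J u hu).restrictField (v.adicCompletion K)) 1) ∧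
    Nat.card (galoisCohomology ((W.twistedTorsionGaloisModule p κ J u hu).restrictField (v.adicCompletion K)) 1) =
      Nat.card (v.adicCompletionIntegers K ⧸ Ideal.span {((p ^ J * p ^ J : ℕ) : v.adicCompletionIntegers K)}) := by
  haveI : NeZero (p ^ J) := neZero_prime_pow p J
  haveI : CharZero (v.adicCompletion K) := charZero_adicCompletion v
  set F := v.adicCompletion K with hF
  haveI := absoluteGaloisGroup_compactSpace F
  haveI : Finite (W.geomTorsion ((p ^ J : ℕ) : ℤ)) := finite_geomTorsion_of_neZero W (p ^ J)
  set ρ : ContinuousRep (absoluteGaloisGroup F) ℤ (W.geomTorsion ((p ^ J : ℕ) : ℤ)) :=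
    (W.twistedTorsionGaloisModule p κ J u hu).restrictField F with hρ
  obtain ⟨h1fin, -, hEq⟩ := localEulerPoincareCharacteristic_adicCompletion K v
    (localEulerPoincareCharacteristic_holds F) ρ
  refine ⟨h1fin, ?_⟩
  -- `#E[p^J] = p^J · p^J`
  have hMn : Nat.card (W.geomTorsion ((p ^ J : ℕ) : ℤ)) = p ^ J * p ^ J := by
    rw [natCard_geomTorsion W (((p ^ J : ℕ) : ℤ)) (by exact_mod_cast NeZero.ne (p ^ J)), Int.natAbs_natCast, sq]
  have h0 : Nat.card ρ.toTopRep.ρ.invariants = 1 := by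
    rw [hρ, invariants_twistedTorsion_restrictField_eq_bot W p κ J u hu v hfix]
    exact Nat.card_of_subsingleton (0 : (⊥ : Submodule ℤ (W.geomTorsion ((p ^ J : ℕ) : ℤ))))
  have h2 : Nat.card (galoisCohomology ρ 2) = 1 :=
    (natCard_galoisCohomology_two_twistedTorsion_eq_one W p κ J u hu v e hμ hadd₁ hadd₂ hgal hnondeg hfix).2
  rw [h0, h2, one_mul, one_mul, hMn] at hEq
  exact hEq.symm

end General

/-! ## §2 `K = ℚ`, `p = 2`: `#H¹(ℚ_v, E[2^J](χ_u)) = 4^J`, unconditionally for `GoodSS W 2` -/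

section Two

/-- `#(R ⧸ (ab)) = #(R ⧸ (a)) · #(R ⧸ (b))` for `a ≠ 0` in a domain. [folklore] -/
private theorem natCard_quotient_span_singleton_mul {R : Type*} [CommRing R] [IsDomain R] {a : R} (ha : a ≠ 0) (b : R) :
    Nat.card (R ⧸ Ideal.span {a * b}) = Nat.card (R ⧸ Ideal.span {a}) * Nat.card (R ⧸ Ideal.span {b}) := by
  have hle : Ideal.span {a * b} ≤ Ideal.span {a} := Ideal.span_singleton_le_span_singleton.mpr ⟨b, rfl⟩
  let f : R ⧸ Ideal.span {a * b} →+* R ⧸ Ideal.span {a} := Ideal.Quotient.factor hle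
  have hf : Surjective f := Ideal.Quotient.factor_surjective hle
  let g : R →+ R ⧸ Ideal.span {a * b} :=
    (Ideal.Quotient.mk (Ideal.span {a * b})).toAddMonoidHom.comp (AddMonoidHom.mulLeft a)
  have hgker : g.ker = (Ideal.span {b}).toAddSubgroup := by
    ext x
    simp only [g, AddMonoidHom.mem_ker, AddMonoidHom.coe_comp, comp_apply, AddMonoidHom.coe_mulLeft,
      RingHom.toAddMonoidHom_eq_coe, AddMonoidHom.coe_coe, Ideal.Quotient.eq_zero_iff_mem,
      Ideal.mem_span_singleton, Submodule.mem_toAddSubgroup]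
    constructor
    · rintro ⟨c, hc⟩
      exact ⟨c, mul_left_cancel₀ ha (by rw [hc, mul_assoc])⟩
    · rintro ⟨c, rfl⟩
      exact ⟨c, by rw [mul_assoc]⟩
  have hgrange : g.range = f.toAddMonoidHom.ker := by
    ext y
    constructor
    · rintro ⟨x, rfl⟩
      simp only [g, f, RingHom.toAddMonoidHom_eq_coe, AddMonoidHom.mem_ker, AddMonoidHom.coe_comp,
        AddMonoidHom.coe_coe, comp_apply, AddMonoidHom.coe_mulLeft, Ideal.Quotient.factor_mk,
        Ideal.Quotient.eq_zero_iff_mem]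
      exact Ideal.mem_span_singleton.mpr ⟨x, rfl⟩
    · intro hy
      obtain ⟨z, rfl⟩ := Ideal.Quotient.mk_surjective y
      simp only [f, RingHom.toAddMonoidHom_eq_coe, AddMonoidHom.mem_ker, AddMonoidHom.coe_coe,
        Ideal.Quotient.factor_mk, Ideal.Quotient.eq_zero_iff_mem, Ideal.mem_span_singleton] at hy
      obtain ⟨c, rfl⟩ := hy
      exact ⟨c, rfl⟩
  have h1 : Nat.card (R ⧸ Ideal.span {a * b}) =
      Nat.card ((R ⧸ Ideal.span {a * b}) ⧸ f.toAddMonoidHom.ker) * Nat.card f.toAddMonoidHom.ker :=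
    AddSubgroup.card_eq_card_quotient_mul_card_addSubgroup _
  have h2 : Nat.card ((R ⧸ Ideal.span {a * b}) ⧸ f.toAddMonoidHom.ker) = Nat.card (R ⧸ Ideal.span {a}) :=
    Nat.card_congr (QuotientAddGroup.quotientKerEquivOfSurjective f.toAddMonoidHom hf).toEquiv
  have h3 : Nat.card f.toAddMonoidHom.ker = Nat.card (R ⧸ Ideal.span {b}) := by
    rw [← hgrange]
    have e := QuotientAddGroup.quotientKerEquivRange g
    rw [← Nat.card_congr e.toEquiv, hgker]
    rfl
  rw [h1, h2, h3]

/-- **`#(ℤ₂ ⧸ 2^k ℤ₂) = 2^k`** at the place `v ∋ 2` of `ℚ` (`#(𝓞_v/2) = 2^{[ℚ:ℚ]}` by the tree's `prod_natCard_quot_adicCompletionIntegers`,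
the place above `2` being unique, and multiplicativity of the index). [folklore] -/
theorem natCard_adicCompletionIntegers_quot_two_pow (v : HeightOneSpectrum (𝓞 ℚ)) (hv : (2 : 𝓞 ℚ) ∈ v.asIdeal) (k : ℕ) :
    Nat.card (v.adicCompletionIntegers ℚ ⧸ Ideal.span {((2 ^ k : ℕ) : v.adicCompletionIntegers ℚ)}) = 2 ^ k := by
  haveI : Fact (Nat.Prime 2) := ⟨Nat.prime_two⟩
  have h2 : Nat.card (v.adicCompletionIntegers ℚ ⧸ Ideal.span {((2 : ℕ) : v.adicCompletionIntegers ℚ)}) = 2 := by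
    have h := WeierstrassCurve.prod_natCard_quot_adicCompletionIntegers (K := ℚ) (p := 2) {v} (fun w hw h2w ↦ hw ?_)
    · rw [Finset.prod_singleton, Module.finrank_self, pow_one] at h
      exact h
    · rw [Finset.mem_singleton]
      apply (Rat.HeightOneSpectrum.primesEquiv (R := 𝓞 ℚ)).injective
      apply Subtype.ext
      rw [Rat.HeightOneSpectrum.primesEquiv_eq_of_natCast_mem w Nat.prime_two h2w,
        Rat.HeightOneSpectrum.primesEquiv_eq_of_natCast_mem v Nat.prime_two (by exact_mod_cast hv)]
  induction k with
  | zero =>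
    rw [pow_zero, Nat.cast_one, Ideal.span_singleton_one]
    haveI : Subsingleton (v.adicCompletionIntegers ℚ ⧸ (⊤ : Ideal (v.adicCompletionIntegers ℚ))) :=
      Ideal.Quotient.subsingleton_iff.mpr rfl
    exact Nat.card_of_subsingleton 0
  | succ k ih =>
    rw [pow_succ', Nat.cast_mul, natCard_quotient_span_singleton_mul (LocalPoints.natCast_ne_zero v two_ne_zero), ih, h2]

variable (W : WeierstrassCurve ℚ) [W.IsElliptic] [W.IsGloballyMinimal]

/-- **(FIX) at `2`, unconditionally**: for `W/ℚ` globally minimal with `GoodSS W 2`, a `ℤ₂`-extension `κ` and `v ∋ 2`, a point of `E[2^J]`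
fixed by the local `Gal(ℚ̄_v/(ℚ_∞)_w)` is zero — it lies in `E(ℚ_{2,∞}·ℚ_v)` (`pointsMapOfEmb_mem_localTowerPointsOfEmb_of_forall_smul`),
which has no `2`-power torsion (`eq_zero_of_mem_localTowerPointsOfEmb_of_pow_nsmul_two`). [cite: Kobayashi2003, Prop. 8.7] [cite: Sprung2012, Lemma 2.3] -/
theorem geomTorsion_eq_zero_of_forall_local_kerSubgroup_smul_eq (hss : Rank1Residual.GoodSS W 2) (κ : ZpExtension ℚ 2) (J : ℕ)
    {v : HeightOneSpectrum (𝓞 ℚ)} (hv : (2 : 𝓞 ℚ) ∈ v.asIdeal) (T : W.geomTorsion ((2 ^ J : ℕ) : ℤ))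
    (hT : ∀ τ : absoluteGaloisGroup (v.adicCompletion ℚ), absGaloisRestrict ℚ (v.adicCompletion ℚ) τ ∈ κ.kerSubgroup →
      absGaloisRestrict ℚ (v.adicCompletion ℚ) τ • T = T) : T = 0 := by
  have hmem := SignedKatoOffTwo.LocalTowerRes.pointsMapOfEmb_mem_localTowerPointsOfEmb_of_forall_smul W κ v
    (T : W.geomPoints) fun x hx ↦ by
    obtain ⟨hker, ⟨τ, rfl⟩⟩ := Subgroup.mem_inf.1 hx
    have h := hT τ hker
    have h' : ((absGaloisRestrict ℚ (v.adicCompletion ℚ) τ • T : W.geomTorsion ((2 ^ J : ℕ) : ℤ)) : W.geomPoints) =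
        (T : W.geomPoints) := by rw [h]
    exact h'
  have h0 : pointsMapOfEmb W (closureEmb (K := ℚ) (v.adicCompletion ℚ)) (T : W.geomPoints) = 0 :=
    SignedKatoOffTwo.LocalTowerRes.eq_zero_of_mem_localTowerPointsOfEmb_of_pow_nsmul_two W hss κ hv _ J hmem (by
      rw [← map_nsmul, ← AddSubgroupClass.coe_nsmul, show (2 ^ J) • T = 0 from ?_, ZeroMemClass.coe_zero, map_zero]
      exact_mod_cast AddSubgroup.torsionBy.nsmul T)
  exact Subtype.ext (pointsMapOfEmb_injective W (closureEmb (K := ℚ) (v.adicCompletion ℚ))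
    (by rw [h0, ZeroMemClass.coe_zero, map_zero]))

/-- **`#H¹(ℚ_v, E[2^J](χ_u)) = 4^J`, `H⁰ = 0`, `#H² = 1` — UNCONDITIONALLY** for `W/ℚ` globally minimal with good supersingular reduction
at `2`, a `ℤ₂`-extension `κ`, `v ∋ 2`, every odd `u`, every `J ≥ 0` and every Weil pairing datum `e` on `E[2^J]` (non-degenerate,
`Γ_ℚ`-equivariant, biadditive, `μ_{2^J}`-valued — `exists_weilPairing_holds`). The COUNTING input of the `±`-duality at `2`
(`#L_u · #L_{u'} = 2^J · 2^J = #H¹`). [cite: MilneADT2006, Ch. I §2, Thm. 2.8 and Cor. 2.3] [cite: BDKim2007, Prop. 3.15] -/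
theorem natCard_galoisCohomology_one_twistedTorsion_two (hss : Rank1Residual.GoodSS W 2) (κ : ZpExtension ℚ 2) (J : ℕ)
    (u : ℤ) (hu : (2 : ℤ) ∣ u - 1) (v : HeightOneSpectrum (𝓞 ℚ)) (hv : (2 : 𝓞 ℚ) ∈ v.asIdeal)
    (e : W.geomTorsion ((2 ^ J : ℕ) : ℤ) → W.geomTorsion ((2 ^ J : ℕ) : ℤ) → AlgebraicClosure ℚ)
    (hμ : ∀ S T, e S T ^ (2 ^ J) = 1) (hadd₁ : ∀ S₁ S₂ T, e (S₁ + S₂) T = e S₁ T * e S₂ T)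
    (hadd₂ : ∀ S T₁ T₂, e S (T₁ + T₂) = e S T₁ * e S T₂)
    (hgal : ∀ (σ : absoluteGaloisGroup ℚ) (S T : W.geomTorsion ((2 ^ J : ℕ) : ℤ)), σ • e S T = e (σ • S) (σ • T))
    (hnondeg : ∀ T, (∀ S, e S T = 1) → T = 0) :
    ((W.twistedTorsionGaloisModule 2 κ J u hu).restrictField (v.adicCompletion ℚ)).toTopRep.ρ.invariants = ⊥ ∧
    Nat.card (galoisCohomology ((W.twistedTorsionGaloisModule 2 κ J u hu).restrictField (v.adicCompletion ℚ)) 2) = 1 ∧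
    Finite (galoisCohomology ((W.twistedTorsionGaloisModule 2 κ J u hu).restrictField (v.adicCompletion ℚ)) 1) ∧
    Nat.card (galoisCohomology ((W.twistedTorsionGaloisModule 2 κ J u hu).restrictField (v.adicCompletion ℚ)) 1) = 4 ^ J := by
  haveI : Fact (Nat.Prime 2) := ⟨Nat.prime_two⟩
  have hfix := fun T hT ↦ geomTorsion_eq_zero_of_forall_local_kerSubgroup_smul_eq W hss κ J hv T hT
  obtain ⟨hfin, hcard⟩ := natCard_galoisCohomology_one_twistedTorsion W 2 κ J u hu v e hμ hadd₁ hadd₂ hgal hnondeg hfix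
  refine ⟨invariants_twistedTorsion_restrictField_eq_bot W 2 κ J u hu v hfix,
    (natCard_galoisCohomology_two_twistedTorsion_eq_one W 2 κ J u hu v e hμ hadd₁ hadd₂ hgal hnondeg hfix).2, hfin, ?_⟩
  rw [hcard, ← pow_add, natCard_adicCompletionIntegers_quot_two_pow v hv, ← two_mul, pow_mul]
  norm_num

end Two

end Summit.BirchSwinnertonDyer.BirchSwinnertonDyer.Theorems.SignedEC.TwistedLocalCount

end
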